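import Literature.MathematicalPhysics.QuantumFieldTheory.Balaban1983to89.T4RootedResidualGauge

/-!
# T4 — THE HIERARCHICALLY ROOTED RESIDUAL GAUGE OF LEVEL `k` ON THE FINE TORUS `T_η`: the transporter through the intermediate centres
# `x ← root₁ x ← root₂ x ← … ← root_k x`, the normal form `U ↦ U^{g_U}`, and its NESTEDNESS `hierGauge j (hierGauge k U) = hierGauge k U` (`j ≤ k`)

Cell `pub-ymgap` (YM-PLAN Track A, node N09 = [Balaban1987RG1] Sects 2–5), seat `pub-ymgap-dag-n09-w3` (g2; D-0149 width seat), FILE 3; helper of K1⁷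
`StabilityBAtRecordR13SepCoPH` = stmt-QuantumFields-20542 (count-neutral).  [I] = [Balaban1987RG1] (CMP 109), [B11] = [Balaban1985Variational] (CMP 102), [B8] =
[Balaban1985RegularSpaces] (CMP 99), [B7] = [Balaban1985Averaging] (CMP 98).  Kernel certificate over the tree's own vocabulary — dag-n09-w4 g2's `T4RootedResidualGauge`
(§1 coordinate paths `pathHol` with the telescoping law `pathHol_gaugeAct`, `pathHol_self`, `pathEnd_finRange`, `measurable_pathHol`; §2 `rootOf`, `rootOf_embIter`,
`blockIter_rootOf`, the one-level `rootTransporter` ∕ `rootGauge`), dag-p07 `B12GaugeOrbits021` (`IsResidual`, `OrbitRel`, `gaugeAct_mul`), r15 `B15Eq177GaugeInvariance`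
(`blockLift`), r08 `B15DeterminingSets.embIter`, `B14.Eq22Determines.blockIter` — used BY NAME, nothing re-declared.

WHY.  The N09 width seats located THREE properties of the minimiser selection `W ↦ U_{k+1}(W)` behind [I] (2.3) ∕ (2.9) that print's axial-gauge minimiser has and the
record's bare choice `Node00.Uk` lacks: measurability (H-U), block-lift covariance (181), and HEREDITARITY «`U_{j+1}(Ū^{j+1}(U_k V)) = U_k V`» (the axial-gauge minimiser
RESTRICTS exactly, [B11] Thm 1 (9)–(10) + (1.1) uniqueness + a complete hierarchical gauge fixing; [B8] (1.19)–(1.20), [B11] p. 281 «exactly one gauge transformation u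
satisfying R̄₀uʲ = 1 on Λ_j»).  dag-n09-w4 g2's ONE-LEVEL rooted gauge `rootGauge k` (coordinate comb from the `k`-block centre) supplies the first two but is NOT nested across
levels (its author, bus 2026-08-28 02:13Z: «NOT hierarchical … not built here»), so a selection read through it is not hereditary.  THIS FILE builds the HIERARCHICAL variant:
the transporter of level `k` at `x` is the holonomy along the chain of coordinate paths `root_k x → root_{k−1} x → … → root_1 x → x` through the centres of the nested blocks
of `x`, and proves, besides the one-level properties (telescoping law, residual, constant on residual orbits, (181)-equivariant under block-constant lifts, measurable), the
NESTEDNESS `hierGauge j (hierGauge k U) = hierGauge k U` for `j ≤ k` — whence ★ `hierGauge_eq_of_orbitRel_hierGauge`: THE LEVEL-`k` NORMAL FORM IS THE LEVEL-`j` NORMAL FORM OF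
ITS WHOLE LEVEL-`j` RESIDUAL ORBIT, the algebraic core of hereditarity (consumer: `Summits/…/BalabanUVNodesN09HereditarySelection`).  Only the transformation law of path
holonomies and the block∕centre bookkeeping of `Setup` are used — no smallness, no estimate.

WHAT IS DEFINED ∕ PROVED (0 `sorry`, 0 `instance`, 0 `notation`):
* §1 cross-level root bookkeeping: `embFrom j i : T^{(j+i)} → T^{(j)}`, `blockFrom j i : T^{(j)} → T^{(j+i)}` (iterated `emb` ∕ `blockOf`), `embIter_levelAdd`, `blockIter_levelAdd`,
  `rootOf_zero`, ★ `rootOf_rootOf_of_le` (a `k`-centre is a `j`-centre, `j ≤ k`), ★ `rootOf_of_le_rootOf` (the `j`-root of `x` has the `k`-root of `x`), `rootOf_self`.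
* §2 `hierTransporter`, `hierGauge`; `hierTransporter_zero ∕ _succ`, `hierGauge_zero`, `hierTransporter_one_eq` ∕ `hierGauge_one_eq_rootGauge` (level 1 = dag-n09-w4's),
  ★ `hierTransporter_gaugeAct` (telescoping `g_{U^u}(x) = u(root_k x)·g_U(x)·u(x)⁻¹`), `hierTransporter_embIter` ∕ `isResidual_hierTransporter` ∕ `hierTransporter_rootOf`,
  `orbitRel_hierGauge`, ★ `hierGauge_gaugeAct_of_isResidual` ∕ `hierGauge_eq_of_orbitRel`, ★ `hierGauge_gaugeAct_blockLift`, `hierTransporter_hierGauge`,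
  ★★ `hierTransporter_eq_one_of_le`, ★★★ `hierGauge_nested`, `hierGauge_idem`, ★★★ `hierGauge_eq_of_orbitRel_hierGauge`, `hierTransporter_unit` ∕ `hierGauge_unit`.
* §3 `measurable_hierTransporter_apply`, ★ `measurable_hierGauge`.

HONEST FRAMING — what this is NOT.  Group algebra on the torus and measurability of finite products; the hierarchical rooted gauge is a coordinate-path VARIANT of print's
hierarchical axial gauge ([B8] (1.19)–(1.20); same residual groups level by level, same transformation laws — the only content consumers use); NOTHING of Bałaban's asserted;
no estimate; no carrier of any record re-pointed (adopting a selection read through `hierGauge` is the record owner's call); counts of the `pub-ymgap` DAG unmoved; one finite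
torus at a time — NOT continuum ∕ ℝ⁴ ∕ OS; the YM mass gap (Clay) is NOT proved by any of this.
-/

noncomputable section

namespace Literature.MathematicalPhysics.QuantumFieldTheory.Balaban1983to89.T4HierRootedGauge

open _root_.MeasureTheory Set
open B12GaugeOrbits021 (OrbitRel IsResidual gaugeAct_mul)
open B15DeterminingSets (embIter)
open B14.Eq22Determines (blockIter)
open B15Eq177GaugeInvariance (blockLift blockIter_embIter)
open B12RTGaugeInvariance254 (gaugeAct_one')
open T4RootedResidualGauge (pathHol pathHol_gaugeAct pathHol_self pathHol_one pathEnd_finRange rootOf rootOf_embIter blockIter_rootOf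
  rootTransporter rootGauge measurable_pathHol)
open GaugeField (gaugeAct)

/-! ## §1  Cross-level bookkeeping of the block roots -/

section Roots

variable {P : Params}

/-- The iterated centre embedding `T^{(j+i)} → T^{(j)}` (`i` applications of `Setup.emb`). [cite: Balaban1987RG1, (0.1) p.251 (bookkeeping)] -/
def embFrom (j : ℕ) : (i : ℕ) → Site P (j + i) → Site P j
  | 0 => fun y => y
  | i + 1 => fun y => embFrom j i (emb y)

/-- The iterated block map `T^{(j)} → T^{(j+i)}` (`i` applications of `Setup.blockOf`). [cite: Balaban1987RG1, (0.3) p.252 (bookkeeping)] -/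
def blockFrom (j : ℕ) : (i : ℕ) → Site P j → Site P (j + i)
  | 0 => fun x => x
  | i + 1 => fun x => blockOf (blockFrom j i x)

/-- Level splitting of the centre embedding: `ι_{j+i} = ι_j ∘ (emb)^i`. [cite: Balaban1987RG1, (0.1) p.251 (bookkeeping)] -/
theorem embIter_levelAdd (j : ℕ) : ∀ (i : ℕ) (y : Site P (j + i)), (embIter (j + i) y : Site P 0) = embIter j (embFrom j i y)
  | 0, _ => rfl
  | i + 1, y => by
      show (embIter (j + i) (emb y) : Site P 0) = embIter j (embFrom j i (emb y))
      exact embIter_levelAdd j i (emb y)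

/-- Level splitting of the iterated block map: `B^{j+i} = (blockOf)^i ∘ B^j`. [cite: Balaban1987RG1, (0.3) p.252 (bookkeeping)] -/
theorem blockIter_levelAdd (j : ℕ) : ∀ (i : ℕ) (x : Site P 0), (blockIter (j + i) x : Site P (j + i)) = blockFrom j i (blockIter j x)
  | 0, _ => rfl
  | i + 1, x => by
      show blockOf (blockIter (j + i) x) = blockOf (blockFrom j i (blockIter j x))
      rw [blockIter_levelAdd j i x]

/-- The level-`0` root of a fine site is the site itself. [cite: Balaban1987RG1, (0.1) p.251 (bookkeeping)] -/
theorem rootOf_zero (x : Site P 0) : rootOf 0 x = x := rfl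

/-- A `(j+i)`-centre is its own `j`-root (standing range `j ≤ m + K`). [cite: Balaban1987RG1, (0.1) p.251 (bookkeeping)] -/
theorem rootOf_embIter_levelAdd {j : ℕ} (i : ℕ) (hj : j ≤ P.m + P.K) (y : Site P (j + i)) :
    rootOf j (embIter (j + i) y : Site P 0) = embIter (j + i) y := by
  rw [embIter_levelAdd, rootOf_embIter hj]

/-- The `j`-root of `x` lies in the `(j+i)`-block of `x`. [cite: Balaban1987RG1, (0.3) p.252 (bookkeeping)] -/
theorem blockIter_levelAdd_rootOf {j : ℕ} (i : ℕ) (hj : j ≤ P.m + P.K) (x : Site P 0) :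
    (blockIter (j + i) (rootOf j x) : Site P (j + i)) = blockIter (j + i) x := by
  rw [blockIter_levelAdd, blockIter_levelAdd, blockIter_rootOf hj]

/-- **★ A `k`-CENTRE IS A `j`-CENTRE** (`j ≤ k`, standing range `j ≤ m + K`): `root_j (root_k x) = root_k x`. [cite: Balaban1987RG1, (0.1) p.251] -/
theorem rootOf_rootOf_of_le {j k : ℕ} (hjk : j ≤ k) (hj : j ≤ P.m + P.K) (x : Site P 0) : rootOf j (rootOf k x) = rootOf k x := by
  obtain ⟨i, rfl⟩ := Nat.exists_eq_add_of_le hjk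
  exact rootOf_embIter_levelAdd i hj (blockIter (j + i) x)

/-- **★ THE `j`-ROOT OF `x` HAS THE `k`-ROOT OF `x`** (`j ≤ k`, standing range `j ≤ m + K`): `root_k (root_j x) = root_k x` (same `k`-block). [cite: Balaban1987RG1, (0.3) p.252] -/
theorem rootOf_of_le_rootOf {j k : ℕ} (hjk : j ≤ k) (hj : j ≤ P.m + P.K) (x : Site P 0) : rootOf k (rootOf j x) = rootOf k x := by
  obtain ⟨i, rfl⟩ := Nat.exists_eq_add_of_le hjk
  show (embIter (j + i) (blockIter (j + i) (rootOf j x)) : Site P 0) = embIter (j + i) (blockIter (j + i) x)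
  rw [blockIter_levelAdd_rootOf i hj x]

/-- `root_k (root_k x) = root_k x`. [cite: Balaban1987RG1, (0.1) p.251 (bookkeeping)] -/
theorem rootOf_self {k : ℕ} (hk : k ≤ P.m + P.K) (x : Site P 0) : rootOf k (rootOf k x) = rootOf k x :=
  rootOf_rootOf_of_le le_rfl hk x

end Roots

/-! ## §2  The hierarchical transporter and the hierarchically rooted gauge of level `k` -/

section Hier

variable {P : Params} {G : Type*} [GaugeGroup G]

/-- **THE HIERARCHICAL TRANSPORTER** of level `k`: `g_U(x) = hol_U(root_k x → root_{k−1} x) · hol_U(root_{k−1} x → root_{k−2} x) · … · hol_U(root_1 x → x)`, each segment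
dag-n09-w4's coordinate-ordered path (`pathHol`) between consecutive roots of `x` — the hierarchical (tree) variant of the axial gauge fixing relative to the nested block
centres, [B8] (1.19)–(1.20) ∕ [B11] p. 281. [cite: Balaban1985RegularSpaces, (1.19) p.80; Balaban1985Variational, (19) p.281] -/
def hierTransporter : ℕ → GaugeField P 0 G → GaugeTransf P 0 G
  | 0, _ => fun _ => 1
  | k + 1, U => fun x => pathHol U (rootOf (k + 1) x) (rootOf k x) (List.finRange P.d) * hierTransporter k U x

/-- **THE HIERARCHICALLY ROOTED GAUGE** `U ↦ U^{g_U}` of level `k` (a NESTED normal form for the residual gauge groups, §2's `hierGauge_nested`).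
[cite: Balaban1985RegularSpaces, (1.19) p.80; Balaban1985Variational, (19) p.281] -/
def hierGauge (k : ℕ) (U : GaugeField P 0 G) : GaugeField P 0 G := gaugeAct (hierTransporter k U) U

/-- Level `0`: the trivial transporter. [cite: Balaban1985Variational, (19) p.281 (bookkeeping)] -/
@[simp] theorem hierTransporter_zero (U : GaugeField P 0 G) : hierTransporter 0 U = fun _ => 1 := rfl

/-- One more level: prepend the segment `root_{k+1} x → root_k x`. [cite: Balaban1985Variational, (19) p.281 (bookkeeping)] -/
theorem hierTransporter_succ (k : ℕ) (U : GaugeField P 0 G) (x : Site P 0) :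
    hierTransporter (k + 1) U x = pathHol U (rootOf (k + 1) x) (rootOf k x) (List.finRange P.d) * hierTransporter k U x := rfl

/-- Level `0`: `hierGauge 0 U = U`. [cite: Balaban1985Variational, (19) p.281 (bookkeeping)] -/
theorem hierGauge_zero (U : GaugeField P 0 G) : hierGauge 0 U = U :=
  gaugeAct_one' U

/-- **LEVEL ONE IS dag-n09-w4's ROOTED TRANSPORTER** (one segment `root_1 x → x`). [cite: Balaban1985Variational, (19) p.281 (bookkeeping)] -/
theorem hierTransporter_one_eq (U : GaugeField P 0 G) : hierTransporter 1 U = rootTransporter 1 U := by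
  funext x
  show pathHol U (rootOf 1 x) (rootOf 0 x) (List.finRange P.d) * 1 = pathHol U (rootOf 1 x) x (List.finRange P.d)
  rw [mul_one, rootOf_zero]

/-- … hence `hierGauge 1 = rootGauge 1`. [cite: Balaban1985Variational, (19) p.281 (bookkeeping)] -/
theorem hierGauge_one_eq_rootGauge (U : GaugeField P 0 G) : hierGauge 1 U = rootGauge 1 U := by
  show gaugeAct (hierTransporter 1 U) U = gaugeAct (rootTransporter 1 U) U
  rw [hierTransporter_one_eq]

/-- **★ TELESCOPING (COVARIANCE OF THE TRANSPORTER)**: `g_{U^u}(x) = u(root_k x) · g_U(x) · u(x)⁻¹` for EVERY gauge transformation `u` — each segment telescopes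
([B7] (8), dag-n09-w4's `pathHol_gaugeAct`) and consecutive segments share their end points. [cite: Balaban1985Averaging, (8) p.19] -/
theorem hierTransporter_gaugeAct (u : GaugeTransf P 0 G) (U : GaugeField P 0 G) :
    ∀ (k : ℕ) (x : Site P 0), hierTransporter k (gaugeAct u U) x = u (rootOf k x) * hierTransporter k U x * (u x)⁻¹
  | 0, x => by
      rw [hierTransporter_zero, hierTransporter_zero, rootOf_zero, mul_one, mul_inv_cancel]
  | k + 1, x => by
      rw [hierTransporter_succ, hierTransporter_succ, pathHol_gaugeAct, pathEnd_finRange, hierTransporter_gaugeAct u U k x]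
      simp only [mul_assoc, inv_mul_cancel_left]

/-- At a `k`-centre the level-`k` transporter is trivial (all its roots coincide; standing range `k ≤ m + K`). [cite: Balaban1985Variational, (19) p.281 (bookkeeping)] -/
theorem hierTransporter_embIter : ∀ (k : ℕ), k ≤ P.m + P.K → ∀ (U : GaugeField P 0 G) (y : Site P k), hierTransporter k U (embIter k y) = 1
  | 0, _, _, _ => rfl
  | k + 1, hk, U, y => by
      rw [hierTransporter_succ, rootOf_embIter hk,
        show rootOf k (embIter (k + 1) y : Site P 0) = embIter (k + 1) y from rootOf_embIter (Nat.le_of_succ_le hk) (emb y),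
        pathHol_self, one_mul]
      exact hierTransporter_embIter k (Nat.le_of_succ_le hk) U (emb y)

/-- **`g_U` IS RESIDUAL OF LEVEL `k`** («u = 1 on T⁽ᵏ⁾», [I] p. 256). [cite: Balaban1987RG1, (0.21) p.256] -/
theorem isResidual_hierTransporter {k : ℕ} (hk : k ≤ P.m + P.K) (U : GaugeField P 0 G) : IsResidual k (hierTransporter k U) :=
  fun y => hierTransporter_embIter k hk U y

/-- The transporter vanishes at every `k`-root. [cite: Balaban1985Variational, (19) p.281 (bookkeeping)] -/
theorem hierTransporter_rootOf {k : ℕ} (hk : k ≤ P.m + P.K) (U : GaugeField P 0 G) (x : Site P 0) : hierTransporter k U (rootOf k x) = 1 :=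
  hierTransporter_embIter k hk U (blockIter k x)

/-- The hierarchical gauge of `U` lies in the residual orbit (level `k`) of `U`. [cite: Balaban1987RG1, (0.21) p.256] -/
theorem orbitRel_hierGauge {k : ℕ} (hk : k ≤ P.m + P.K) (U : GaugeField P 0 G) : OrbitRel k U (hierGauge k U) :=
  ⟨hierTransporter k U, isResidual_hierTransporter hk U, rfl⟩

/-- **★ THE HIERARCHICAL GAUGE IS CONSTANT ON RESIDUAL ORBITS**: `(U^u)^{g_{U^u}} = U^{g_U}` for `u = 1` on `T⁽ᵏ⁾` (`g_{U^u} = g_U·u⁻¹` pointwise, since `u(root_k x) = 1`).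
[cite: Balaban1987RG1, (0.21) p.256; Balaban1985Variational, (19) p.281] -/
theorem hierGauge_gaugeAct_of_isResidual {k : ℕ} {u : GaugeTransf P 0 G} (hu : IsResidual k u) (U : GaugeField P 0 G) :
    hierGauge k (gaugeAct u U) = hierGauge k U := by
  unfold hierGauge
  rw [← gaugeAct_mul]
  congr 1
  funext x
  show hierTransporter k (gaugeAct u U) x * u x = hierTransporter k U x
  rw [hierTransporter_gaugeAct, show u (rootOf k x) = 1 from hu (blockIter k x), one_mul, inv_mul_cancel_right]

/-- Two configurations in one residual orbit (level `k`) have the SAME hierarchical gauge of level `k`. [cite: Balaban1987RG1, (0.21) p.256] -/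
theorem hierGauge_eq_of_orbitRel {k : ℕ} {U U' : GaugeField P 0 G} (h : OrbitRel k U U') : hierGauge k U' = hierGauge k U := by
  obtain ⟨u, hu, rfl⟩ := h
  exact hierGauge_gaugeAct_of_isResidual hu U

/-- **★ EQUIVARIANCE UNDER BLOCK-CONSTANT LIFTS** ([B11] (181) «v̄ is constant on blocks B^j(y) … and equal to v(y)»): for `v̄ = blockLift k v`,
`(U^{v̄})^{g_{U^{v̄}}} = (U^{g_U})^{v̄}` — every root of `x` lies in the `k`-block of `x`, so `v̄(root_k x) = v̄(x)`. [cite: Balaban1985Variational, (181) p.307] -/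
theorem hierGauge_gaugeAct_blockLift {k : ℕ} (hk : k ≤ P.m + P.K) (v : GaugeTransf P k G) (U : GaugeField P 0 G) :
    hierGauge k (gaugeAct (blockLift k v) U) = gaugeAct (blockLift k v) (hierGauge k U) := by
  unfold hierGauge
  rw [← gaugeAct_mul, ← gaugeAct_mul]
  congr 1
  funext x
  show hierTransporter k (gaugeAct (blockLift k v) U) x * blockLift k v x = blockLift k v x * hierTransporter k U x
  rw [hierTransporter_gaugeAct, show blockLift k v (rootOf k x) = blockLift k v x from by
    show v (blockIter k (rootOf k x)) = v (blockIter k x); rw [blockIter_rootOf hk], inv_mul_cancel_right]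

/-- The hierarchical transporter of the hierarchical gauge is trivial: `g_{U^{g_U}} ≡ 1`. [cite: Balaban1985Variational, (19) p.281 (bookkeeping)] -/
theorem hierTransporter_hierGauge {k : ℕ} (hk : k ≤ P.m + P.K) (U : GaugeField P 0 G) (x : Site P 0) : hierTransporter k (hierGauge k U) x = 1 := by
  unfold hierGauge
  rw [hierTransporter_gaugeAct, hierTransporter_rootOf hk, one_mul, mul_inv_cancel]

/-- **★★ DOWNWARD PROPAGATION OF TRIVIALITY**: if the level-`k` hierarchical transporter of `W` is trivial everywhere, so is the level-`j` one for every `j ≤ k`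
(standing range `k ≤ m + K`) — evaluate at the `(k−1)`-root of `x` to kill the top segment, then peel. [cite: Balaban1985RegularSpaces, (1.19)–(1.20) p.80] -/
theorem hierTransporter_eq_one_of_le {j k : ℕ} (hjk : j ≤ k) (hk : k ≤ P.m + P.K) {W : GaugeField P 0 G}
    (h : ∀ x, hierTransporter k W x = 1) : ∀ x, hierTransporter j W x = 1 := by
  obtain ⟨i, rfl⟩ := Nat.exists_eq_add_of_le hjk
  induction i with
  | zero => exact h
  | succ i ih =>
      have hji : j + i ≤ P.m + P.K := by omega
      refine ih (Nat.le_add_right j i) hji ?_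
      intro x
      -- the top segment `root_{j+i+1} x → root_{j+i} x` has trivial holonomy: evaluate `h` at `root_{j+i} x`
      have hseg : pathHol W (rootOf (j + i + 1) x) (rootOf (j + i) x) (List.finRange P.d) = 1 := by
        have h1 : hierTransporter (j + i + 1) W (rootOf (j + i) x) = 1 := h (rootOf (j + i) x)
        rw [hierTransporter_succ, rootOf_of_le_rootOf (Nat.le_succ _) hji, rootOf_self hji, hierTransporter_rootOf hji, mul_one] at h1
        exact h1
      have h2 : hierTransporter (j + i + 1) W x = 1 := h x
      rw [hierTransporter_succ, hseg, one_mul] at h2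
      exact h2

/-- **★★★ NESTEDNESS**: `hierGauge j (hierGauge k U) = hierGauge k U` for `j ≤ k ≤ m + K` — a configuration in the level-`k` hierarchical gauge IS in every lower
hierarchical gauge (its level-`j` transporter is trivial).  This is the property dag-n09-w4's one-level `rootGauge` does not have.
[cite: Balaban1985RegularSpaces, (1.19)–(1.20) p.80; Balaban1985Variational, (19) p.281] -/
theorem hierGauge_nested {j k : ℕ} (hjk : j ≤ k) (hk : k ≤ P.m + P.K) (U : GaugeField P 0 G) : hierGauge j (hierGauge k U) = hierGauge k U := by
  have h1 : hierTransporter j (hierGauge k U) = fun _ => 1 :=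
    funext (hierTransporter_eq_one_of_le hjk hk (hierTransporter_hierGauge hk U))
  show gaugeAct (hierTransporter j (hierGauge k U)) (hierGauge k U) = hierGauge k U
  rw [h1]
  exact gaugeAct_one' _

/-- Idempotence (the case `j = k`). [cite: Balaban1985Variational, (19) p.281 (bookkeeping)] -/
theorem hierGauge_idem {k : ℕ} (hk : k ≤ P.m + P.K) (U : GaugeField P 0 G) : hierGauge k (hierGauge k U) = hierGauge k U :=
  hierGauge_nested le_rfl hk U

/-- **★★★ THE LEVEL-`k` NORMAL FORM IS THE LEVEL-`j` NORMAL FORM OF ITS WHOLE LEVEL-`j` RESIDUAL ORBIT** (`j ≤ k ≤ m + K`): if `U′` lies in the residual orbit of level `j` of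
`hierGauge k U`, then `hierGauge j U′ = hierGauge k U` — the algebraic core of HEREDITARITY of a hierarchically gauge-fixed minimiser selection ([B11] Thm 1 (9)–(10) + (1.1):
the level-`k` minimiser is a level-`(j+1)` minimiser of its own average, unique modulo the level-`(j+1)` residual group). [cite: Balaban1985Variational, (19) p.281 and Thm 1 p.279; Balaban1987RG1, (2.3) p.265] -/
theorem hierGauge_eq_of_orbitRel_hierGauge {j k : ℕ} (hjk : j ≤ k) (hk : k ≤ P.m + P.K) {U U' : GaugeField P 0 G} (h : OrbitRel j (hierGauge k U) U') :
    hierGauge j U' = hierGauge k U := by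
  rw [hierGauge_eq_of_orbitRel h, hierGauge_nested hjk hk]

/-- The unit configuration has trivial hierarchical transporters. [cite: Balaban1985Variational, (19) p.281 (bookkeeping)] -/
theorem hierTransporter_unit : ∀ (k : ℕ), hierTransporter k (1 : GaugeField P 0 G) = fun _ => 1
  | 0 => rfl
  | k + 1 => by
      funext x
      rw [hierTransporter_succ, pathHol_one, one_mul, hierTransporter_unit k]

/-- `hierGauge k 1 = 1` (the junk default of the record's selections is fixed). [cite: Balaban1985Variational, (19) p.281 (bookkeeping)] -/
theorem hierGauge_unit (k : ℕ) : hierGauge k (1 : GaugeField P 0 G) = 1 := by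
  show gaugeAct (hierTransporter k 1) (1 : GaugeField P 0 G) = 1
  rw [hierTransporter_unit]
  exact gaugeAct_one' _

end Hier

/-! ## §3  Measurability of the hierarchical gauge (any measurable group; `SU(N)` by instance) -/

section Measurable

variable {P : Params} {G : Type*} [GaugeGroup G] [MeasurableSpace G] [MeasurableMul₂ G] [MeasurableInv G]

omit [GaugeGroup G] [MeasurableMul₂ G] [MeasurableInv G] in
/-- Each bond variable is a measurable function of the configuration (product σ-algebra of `Setup`). [cite: Balaban1987RG1, (0.21) p.256 (bookkeeping)] -/
private theorem measurable_apply' {j : ℕ} (b : PBond P j) : Measurable fun U : GaugeField P j G => U b :=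
  measurable_pi_apply b

omit [MeasurableInv G] in
/-- The hierarchical transporter at a site is measurable in `U` (finite product of path holonomies, dag-n09-w4's `measurable_pathHol`).
[cite: Balaban1987RG1, (0.21) p.256 (bookkeeping)] -/
theorem measurable_hierTransporter_apply : ∀ (k : ℕ) (x : Site P 0), Measurable fun U : GaugeField P 0 G => hierTransporter k U x
  | 0, _ => measurable_const
  | k + 1, x => (measurable_pathHol _ _ _).mul (measurable_hierTransporter_apply k x)

/-- **★ The hierarchical gauge `U ↦ U^{g_U}` is a MEASURABLE self-map of the configuration space** — so a selection `hierGauge k ∘ f` through a measurable selector `f` is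
measurable ((H-U)). [cite: Balaban1987RG1, (0.21) p.256 (bookkeeping)] -/
theorem measurable_hierGauge (k : ℕ) : Measurable (hierGauge k : GaugeField P 0 G → GaugeField P 0 G) := by
  refine measurable_pi_lambda _ fun b => ?_
  exact ((measurable_hierTransporter_apply k b.src).mul (measurable_apply' b)).mul (measurable_hierTransporter_apply k b.tgt).inv

end Measurable

end Literature.MathematicalPhysics.QuantumFieldTheory.Balaban1983to89.T4HierRootedGauge

end
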